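import Mathlib.Analysis.InnerProductSpace.Adjoint
import HarnessLib

/-!
# NE7RestrictedOperator — RESTRICTING THE OPERATORS OF (E3‴) TO AN INVARIANT PAIR OF SUBSPACES (the skew torus 1-forms): the restriction of a
# continuous linear map to `K → K′` exists as a CLM, its adjoint is the restriction of the adjoint when the adjoint maps `K′` into `K`, and the
# Gram bounds of the adjoint, the operator norm and the distance `‖S − S′‖` all survive the restriction

Cell `pub-balaban`, rung (B)+1 sub-cell t4, lineage `b2b-balaban-t4-ne7-p1`, generation 63 (CRUX PROVER NE7 #1, ruling e34b3e0c (2)); hunt (h7)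
«ENERGY ROAD», identification step (h7-e).  WHY.  (E3‴) (`NE7TensionKernelPerturbed.normSq_le_of_exact_annihilator_near`) is to be applied on the
SKEW torus 1-forms: the exact current `τ` is `θ₀`-close to the tension pairing only on skew directions (`NE7ExactCurrent`), `τ` annihilates
`ker QbarIter` only among skew directions (`NE7ExactCurrentQbarKernel`), while the comb line sum `S′` and its adjoint `WadWg` are written on ALL
matrix-valued forms (`NE7CombLineSumCoercive`) and preserve skewness.  THIS FILE is the abstract device (real inner-product spaces, 0 def):
§1 **`exists_restrict`** — for `S : E →L[ℝ] F` mapping a submodule `K` into a submodule `K′` there is `S_r : K →L[ℝ] K′` with `(S_r x : F) = S x`;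
§2 **`adjoint_restrict_apply`** — if moreover `S†` maps `K′` into `K` (complete `E, F, K, K′`), then `((S_r)† y : E) = S† y`; hence
   **`adjoint_restrict_lower`** ∕ **`adjoint_restrict_upper`**: the Gram bounds `λ‖y‖² ≤ ‖S†y‖² ≤ Λ²‖y‖²` on `K′` pass to `S_r`;
§3 **`opNorm_restrict_sub_le`** — for two such restrictions, `‖S_r − S′_r‖ ≤ ‖S − S′‖`; `norm_restrict_apply` (`‖S_r x‖ = ‖S x‖`).
HONEST FRAMING (page 1): functional analysis only; nothing about Bałaban's minimisers; NE7, NE3 NOT PRINTED in [Balaban1984PropagatorsI]–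
[Balaban1989LargeFieldII] and NOT PROVED; FIXED FINITE torus, rung (B)+1; continuum YM on T⁴ ⇐ BetaPertH ∧ nine spine estimates (0/9 proved);
BetaPertH ⇐ (D1) ∧ (D4) ∧ CAP+tail; G-an2-4 gates asym, D1 and NE2/3/4; NOT infinite volume, NOT mass gap, NOT Clay.  0 def, 0 sorry.
-/

set_option autoImplicit false

open scoped InnerProductSpace

namespace Summit.QuantumFields.BalabanUV.T4Continuum.NE7RestrictedOperator

variable {E F : Type*} [NormedAddCommGroup E] [InnerProductSpace ℝ E] [NormedAddCommGroup F] [InnerProductSpace ℝ F]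

/-! ## §1 The restriction to an invariant pair of subspaces -/

/-- **THE RESTRICTION EXISTS AS A CLM**: if `S` maps `K` into `K′`, there is `S_r : K →L[ℝ] K′` with `(S_r x : F) = S x` for all `x ∈ K`. [folklore] -/
theorem exists_restrict (S : E →L[ℝ] F) (K : Submodule ℝ E) (K' : Submodule ℝ F) (hS : ∀ x ∈ K, S x ∈ K') :
    ∃ Sr : K →L[ℝ] K', ∀ x : K, (Sr x : F) = S (x : E) :=
  ⟨(S.comp K.subtypeL).codRestrict K' (fun x => hS x x.2), fun _ => rfl⟩

/-- The restriction has the same values, hence the same pointwise norms. [folklore] -/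
theorem norm_restrict_apply {S : E →L[ℝ] F} {K : Submodule ℝ E} {K' : Submodule ℝ F} {Sr : K →L[ℝ] K'}
    (hSr : ∀ x : K, (Sr x : F) = S (x : E)) (x : K) : ‖Sr x‖ = ‖S (x : E)‖ := by
  rw [← hSr x, Submodule.coe_norm]

/-! ## §2 The adjoint of the restriction is the restriction of the adjoint -/

/-- **`((S_r)† y : E) = S† y`** whenever `S†` maps `K′` into `K` (so that the right-hand side is the value of a vector of `K`). [folklore] -/
theorem adjoint_restrict_apply [CompleteSpace E] [CompleteSpace F] {S : E →L[ℝ] F} {K : Submodule ℝ E} {K' : Submodule ℝ F}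
    [CompleteSpace K] [CompleteSpace K'] {Sr : K →L[ℝ] K'} (hSr : ∀ x : K, (Sr x : F) = S (x : E))
    (hadj : ∀ y ∈ K', ContinuousLinearMap.adjoint S y ∈ K) (y : K') :
    (ContinuousLinearMap.adjoint Sr y : E) = ContinuousLinearMap.adjoint S (y : F) := by
  -- the candidate vector of `K`
  set w : K := ⟨ContinuousLinearMap.adjoint S (y : F), hadj y y.2⟩ with hw
  have h : ContinuousLinearMap.adjoint Sr y = w := by
    refine ext_inner_right ℝ fun x => ?_
    rw [ContinuousLinearMap.adjoint_inner_left, Submodule.coe_inner, Submodule.coe_inner, hSr x, hw]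
    exact (ContinuousLinearMap.adjoint_inner_left S x (y : F)).symm
  rw [h]

/-- **LOWER GRAM BOUND OF THE RESTRICTED ADJOINT**: `λ‖y‖² ≤ ‖S†y‖²` for `y ∈ K′` gives `λ‖y‖² ≤ ‖(S_r)†y‖²` on `K′`. [folklore] -/
theorem adjoint_restrict_lower [CompleteSpace E] [CompleteSpace F] {S : E →L[ℝ] F} {K : Submodule ℝ E} {K' : Submodule ℝ F}
    [CompleteSpace K] [CompleteSpace K'] {Sr : K →L[ℝ] K'} (hSr : ∀ x : K, (Sr x : F) = S (x : E))
    (hadj : ∀ y ∈ K', ContinuousLinearMap.adjoint S y ∈ K) {lam : ℝ}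
    (hlow : ∀ y ∈ K', lam * ‖y‖ ^ 2 ≤ ‖ContinuousLinearMap.adjoint S y‖ ^ 2) :
    ∀ y : K', lam * ‖y‖ ^ 2 ≤ ‖ContinuousLinearMap.adjoint Sr y‖ ^ 2 := by
  intro y
  have e1 : ‖y‖ = ‖(y : F)‖ := rfl
  have e2 : ‖ContinuousLinearMap.adjoint Sr y‖ = ‖(ContinuousLinearMap.adjoint Sr y : E)‖ := rfl
  rw [e1, e2, adjoint_restrict_apply hSr hadj y]
  exact hlow y y.2

/-- **UPPER GRAM BOUND OF THE RESTRICTED ADJOINT**: `‖S†y‖² ≤ Λ²‖y‖²` for `y ∈ K′` gives the same for `(S_r)†`. [folklore] -/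
theorem adjoint_restrict_upper [CompleteSpace E] [CompleteSpace F] {S : E →L[ℝ] F} {K : Submodule ℝ E} {K' : Submodule ℝ F}
    [CompleteSpace K] [CompleteSpace K'] {Sr : K →L[ℝ] K'} (hSr : ∀ x : K, (Sr x : F) = S (x : E))
    (hadj : ∀ y ∈ K', ContinuousLinearMap.adjoint S y ∈ K) {Lam : ℝ}
    (hup : ∀ y ∈ K', ‖ContinuousLinearMap.adjoint S y‖ ^ 2 ≤ Lam ^ 2 * ‖y‖ ^ 2) :
    ∀ y : K', ‖ContinuousLinearMap.adjoint Sr y‖ ^ 2 ≤ Lam ^ 2 * ‖y‖ ^ 2 := by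
  intro y
  have e1 : ‖y‖ = ‖(y : F)‖ := rfl
  have e2 : ‖ContinuousLinearMap.adjoint Sr y‖ = ‖(ContinuousLinearMap.adjoint Sr y : E)‖ := rfl
  rw [e1, e2, adjoint_restrict_apply hSr hadj y]
  exact hup y y.2

/-! ## §3 Distances and norms survive the restriction -/

/-- **`‖S_r − S′_r‖ ≤ ‖S − S′‖`** for the restrictions of two maps to the same pair of subspaces. [folklore] -/
theorem opNorm_restrict_sub_le {S S' : E →L[ℝ] F} {K : Submodule ℝ E} {K' : Submodule ℝ F} {Sr S'r : K →L[ℝ] K'}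
    (hSr : ∀ x : K, (Sr x : F) = S (x : E)) (hS'r : ∀ x : K, (S'r x : F) = S' (x : E)) : ‖Sr - S'r‖ ≤ ‖S - S'‖ := by
  refine ContinuousLinearMap.opNorm_le_bound _ (norm_nonneg _) fun x => ?_
  have e : ‖(Sr - S'r) x‖ = ‖(S - S') (x : E)‖ := by
    show ‖((Sr x - S'r x : K') : F)‖ = ‖S (x : E) - S' (x : E)‖
    rw [Submodule.coe_sub, hSr, hS'r]
  have ex : ‖x‖ = ‖(x : E)‖ := rfl
  rw [e, ex]
  exact ContinuousLinearMap.le_opNorm _ _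

/-- A pointwise bound `‖S x − S′ x‖ ≤ δ‖x‖` on `K` gives `‖S_r − S′_r‖ ≤ δ`. [folklore] -/
theorem opNorm_restrict_sub_le_of_bound {S S' : E →L[ℝ] F} {K : Submodule ℝ E} {K' : Submodule ℝ F} {Sr S'r : K →L[ℝ] K'}
    (hSr : ∀ x : K, (Sr x : F) = S (x : E)) (hS'r : ∀ x : K, (S'r x : F) = S' (x : E)) {δ : ℝ} (hδ : 0 ≤ δ)
    (hb : ∀ x ∈ K, ‖S x - S' x‖ ≤ δ * ‖x‖) : ‖Sr - S'r‖ ≤ δ := by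
  refine ContinuousLinearMap.opNorm_le_bound _ hδ fun x => ?_
  have e : ‖(Sr - S'r) x‖ = ‖S (x : E) - S' (x : E)‖ := by
    show ‖((Sr x - S'r x : K') : F)‖ = ‖S (x : E) - S' (x : E)‖
    rw [Submodule.coe_sub, hSr, hS'r]
  have ex : ‖x‖ = ‖(x : E)‖ := rfl
  rw [e, ex]
  exact hb x x.2

end Summit.QuantumFields.BalabanUV.T4Continuum.NE7RestrictedOperator
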